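import Summits.SmoothPoincare4.SmoothPoincare4.Theorems.EntropyRungCompactShrinkerGapLevelSetCertBase
import HarnessLib

/-!
# Level-set certificate for crux `EntropyRung.CompactShrinkerGap` (stmt-SmoothPoincare4-10870) — chunk k = 0 (`0 ≤ f ≤ 1 / 2`)

Sibling of `EntropyRungCompactShrinkerGapLevelSetCertBase.lean` (method and provenance in its module docstring): the polynomial
Handelman certificates and the assembly of STUB 19's inequality `Q(f,R) ≤ 0` on the chunk of this file. Everything proved;
no geometry. [cite: ChengRibeiroZhou2022, §3.2 (the CRZ member)] -/

noncomputable section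

namespace Summit.SmoothPoincare4.SmoothPoincare4.Theorems

set_option linter.dupNamespace false
set_option maxHeartbeats 800000

/-! ## Chunk k = 0: `0 ≤ f ≤ 1 / 2` — polynomial certificates and assembly -/

/-- Handelman certificate: chunk `f ∈ [0, 1 / 2]`, `R ∈ [0, f]`, envelope corner `e^{-f}` → lo, `e^{7/2−f}` → hi (exact identity with 34 nonnegative product terms, slack 4.1461). [folklore] -/
theorem cert_0_0_lo (f R : ℝ) (_hs : 0 ≤ f) (hts : 0 ≤ 1 / 2 - f) (hR : 0 ≤ R) (hRf : 0 ≤ f - R) :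
    (-2 + 11 / 10 * (R - 2) + 12 / 25 * ((f - R) * (3 - R) - (R - 2) ^ 2) - 1 / 2 * R * (2 - R)) + (1 * ((1 - f + f ^ 2 / 2 - f ^ 3 / 6 + f ^ 4 / 24) - f ^ 5 / 100)) * (38 / 5 + 177 / 10 * (f - 2) - 18 / 5 * ((f - R) - (f - 2) ^ 2))
      + (1655773 / 50000 * ((1 - f + f ^ 2 / 2 - f ^ 3 / 6 + f ^ 4 / 24) + f ^ 5 / 100)) * (1 / 2 * R * (2 - R)) ≤ 0 := by
  have g0 : (0 : ℝ) ≤ (f - R) := hRf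
  have g1 : (0 : ℝ) ≤ (f - R) ^ 2 := pow_nonneg hRf 2
  have g2 : (0 : ℝ) ≤ (f - R) ^ 3 := pow_nonneg hRf 3
  have g3 : (0 : ℝ) ≤ (f - R) ^ 5 := pow_nonneg hRf 5
  have g4 : (0 : ℝ) ≤ (f - R) ^ 7 := pow_nonneg hRf 7
  have g5 : (0 : ℝ) ≤ R * (f - R) ^ 2 := mul_nonneg (hR) (pow_nonneg hRf 2)
  have g6 : (0 : ℝ) ≤ R * (f - R) ^ 3 := mul_nonneg (hR) (pow_nonneg hRf 3)
  have g7 : (0 : ℝ) ≤ R * (f - R) ^ 4 := mul_nonneg (hR) (pow_nonneg hRf 4)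
  have g8 : (0 : ℝ) ≤ R * (f - R) ^ 6 := mul_nonneg (hR) (pow_nonneg hRf 6)
  have g9 : (0 : ℝ) ≤ R ^ 2 * (f - R) ^ 2 := mul_nonneg (pow_nonneg hR 2) (pow_nonneg hRf 2)
  have g10 : (0 : ℝ) ≤ R ^ 2 * (f - R) ^ 5 := mul_nonneg (pow_nonneg hR 2) (pow_nonneg hRf 5)
  have g11 : (0 : ℝ) ≤ R ^ 3 * (f - R) := mul_nonneg (pow_nonneg hR 3) (hRf)
  have g12 : (0 : ℝ) ≤ R ^ 3 * (f - R) ^ 2 := mul_nonneg (pow_nonneg hR 3) (pow_nonneg hRf 2)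
  have g13 : (0 : ℝ) ≤ R ^ 3 * (f - R) ^ 4 := mul_nonneg (pow_nonneg hR 3) (pow_nonneg hRf 4)
  have g14 : (0 : ℝ) ≤ R ^ 4 * (f - R) ^ 3 := mul_nonneg (pow_nonneg hR 4) (pow_nonneg hRf 3)
  have g15 : (0 : ℝ) ≤ R ^ 5 * (f - R) ^ 2 := mul_nonneg (pow_nonneg hR 5) (pow_nonneg hRf 2)
  have g16 : (0 : ℝ) ≤ R ^ 6 * (f - R) := mul_nonneg (pow_nonneg hR 6) (hRf)
  have g17 : (0 : ℝ) ≤ (1 / 2 - f) := hts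
  have g18 : (0 : ℝ) ≤ (1 / 2 - f) * (f - R) := mul_nonneg (hts) (hRf)
  have g19 : (0 : ℝ) ≤ (1 / 2 - f) * (f - R) ^ 3 := mul_nonneg (hts) (pow_nonneg hRf 3)
  have g20 : (0 : ℝ) ≤ (1 / 2 - f) * (f - R) ^ 5 := mul_nonneg (hts) (pow_nonneg hRf 5)
  have g21 : (0 : ℝ) ≤ (1 / 2 - f) * R * (f - R) := mul_nonneg (mul_nonneg (hts) (hR)) (hRf)
  have g22 : (0 : ℝ) ≤ (1 / 2 - f) * R * (f - R) ^ 4 := mul_nonneg (mul_nonneg (hts) (hR)) (pow_nonneg hRf 4)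
  have g23 : (0 : ℝ) ≤ (1 / 2 - f) * R ^ 2 := mul_nonneg (hts) (pow_nonneg hR 2)
  have g24 : (0 : ℝ) ≤ (1 / 2 - f) * R ^ 2 * (f - R) ^ 2 := mul_nonneg (mul_nonneg (hts) (pow_nonneg hR 2)) (pow_nonneg hRf 2)
  have g25 : (0 : ℝ) ≤ (1 / 2 - f) * R ^ 2 * (f - R) ^ 3 := mul_nonneg (mul_nonneg (hts) (pow_nonneg hR 2)) (pow_nonneg hRf 3)
  have g26 : (0 : ℝ) ≤ (1 / 2 - f) * R ^ 3 * (f - R) := mul_nonneg (mul_nonneg (hts) (pow_nonneg hR 3)) (hRf)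
  have g27 : (0 : ℝ) ≤ (1 / 2 - f) * R ^ 3 * (f - R) ^ 2 := mul_nonneg (mul_nonneg (hts) (pow_nonneg hR 3)) (pow_nonneg hRf 2)
  have g28 : (0 : ℝ) ≤ (1 / 2 - f) * R ^ 4 := mul_nonneg (hts) (pow_nonneg hR 4)
  have g29 : (0 : ℝ) ≤ (1 / 2 - f) * R ^ 4 * (f - R) := mul_nonneg (mul_nonneg (hts) (pow_nonneg hR 4)) (hRf)
  have g30 : (0 : ℝ) ≤ (1 / 2 - f) ^ 2 := pow_nonneg hts 2
  have g31 : (0 : ℝ) ≤ (1 / 2 - f) ^ 2 * R ^ 2 := mul_nonneg (pow_nonneg hts 2) (pow_nonneg hR 2)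
  have g32 : (0 : ℝ) ≤ (1 / 2 - f) ^ 2 * R ^ 4 := mul_nonneg (pow_nonneg hts 2) (pow_nonneg hR 4)
  have g33 : (0 : ℝ) ≤ (1 / 2 - f) ^ 2 * R ^ 5 := mul_nonneg (pow_nonneg hts 2) (pow_nonneg hR 5)
  linarith [g0, g1, g2, g3, g4, g5, g6, g7, g8, g9, g10, g11, g12, g13, g14, g15, g16, g17, g18, g19, g20, g21, g22, g23, g24, g25, g26, g27, g28, g29, g30, g31, g32, g33]

/-- Handelman certificate: chunk `f ∈ [0, 1 / 2]`, `R ∈ [0, f]`, envelope corner `e^{-f}` → hi, `e^{7/2−f}` → hi (exact identity with 35 nonnegative product terms, slack 4.1529). [folklore] -/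
theorem cert_0_0_hi (f R : ℝ) (_hs : 0 ≤ f) (hts : 0 ≤ 1 / 2 - f) (hR : 0 ≤ R) (hRf : 0 ≤ f - R) :
    (-2 + 11 / 10 * (R - 2) + 12 / 25 * ((f - R) * (3 - R) - (R - 2) ^ 2) - 1 / 2 * R * (2 - R)) + (1 * ((1 - f + f ^ 2 / 2 - f ^ 3 / 6 + f ^ 4 / 24) + f ^ 5 / 100)) * (38 / 5 + 177 / 10 * (f - 2) - 18 / 5 * ((f - R) - (f - 2) ^ 2))
      + (1655773 / 50000 * ((1 - f + f ^ 2 / 2 - f ^ 3 / 6 + f ^ 4 / 24) + f ^ 5 / 100)) * (1 / 2 * R * (2 - R)) ≤ 0 := by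
  have g0 : (0 : ℝ) ≤ (f - R) := hRf
  have g1 : (0 : ℝ) ≤ (f - R) ^ 2 := pow_nonneg hRf 2
  have g2 : (0 : ℝ) ≤ (f - R) ^ 3 := pow_nonneg hRf 3
  have g3 : (0 : ℝ) ≤ (f - R) ^ 5 := pow_nonneg hRf 5
  have g4 : (0 : ℝ) ≤ (f - R) ^ 7 := pow_nonneg hRf 7
  have g5 : (0 : ℝ) ≤ R * (f - R) ^ 2 := mul_nonneg (hR) (pow_nonneg hRf 2)
  have g6 : (0 : ℝ) ≤ R * (f - R) ^ 3 := mul_nonneg (hR) (pow_nonneg hRf 3)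
  have g7 : (0 : ℝ) ≤ R * (f - R) ^ 4 := mul_nonneg (hR) (pow_nonneg hRf 4)
  have g8 : (0 : ℝ) ≤ R * (f - R) ^ 5 := mul_nonneg (hR) (pow_nonneg hRf 5)
  have g9 : (0 : ℝ) ≤ R ^ 2 * (f - R) ^ 2 := mul_nonneg (pow_nonneg hR 2) (pow_nonneg hRf 2)
  have g10 : (0 : ℝ) ≤ R ^ 3 * (f - R) := mul_nonneg (pow_nonneg hR 3) (hRf)
  have g11 : (0 : ℝ) ≤ R ^ 4 * (f - R) := mul_nonneg (pow_nonneg hR 4) (hRf)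
  have g12 : (0 : ℝ) ≤ R ^ 4 * (f - R) ^ 2 := mul_nonneg (pow_nonneg hR 4) (pow_nonneg hRf 2)
  have g13 : (0 : ℝ) ≤ R ^ 4 * (f - R) ^ 3 := mul_nonneg (pow_nonneg hR 4) (pow_nonneg hRf 3)
  have g14 : (0 : ℝ) ≤ R ^ 5 * (f - R) ^ 2 := mul_nonneg (pow_nonneg hR 5) (pow_nonneg hRf 2)
  have g15 : (0 : ℝ) ≤ R ^ 6 * (f - R) := mul_nonneg (pow_nonneg hR 6) (hRf)
  have g16 : (0 : ℝ) ≤ (1 / 2 - f) := hts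
  have g17 : (0 : ℝ) ≤ (1 / 2 - f) * (f - R) := mul_nonneg (hts) (hRf)
  have g18 : (0 : ℝ) ≤ (1 / 2 - f) * (f - R) ^ 3 := mul_nonneg (hts) (pow_nonneg hRf 3)
  have g19 : (0 : ℝ) ≤ (1 / 2 - f) * (f - R) ^ 5 := mul_nonneg (hts) (pow_nonneg hRf 5)
  have g20 : (0 : ℝ) ≤ (1 / 2 - f) * (f - R) ^ 6 := mul_nonneg (hts) (pow_nonneg hRf 6)
  have g21 : (0 : ℝ) ≤ (1 / 2 - f) * R * (f - R) := mul_nonneg (mul_nonneg (hts) (hR)) (hRf)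
  have g22 : (0 : ℝ) ≤ (1 / 2 - f) * R * (f - R) ^ 3 := mul_nonneg (mul_nonneg (hts) (hR)) (pow_nonneg hRf 3)
  have g23 : (0 : ℝ) ≤ (1 / 2 - f) * R * (f - R) ^ 4 := mul_nonneg (mul_nonneg (hts) (hR)) (pow_nonneg hRf 4)
  have g24 : (0 : ℝ) ≤ (1 / 2 - f) * R * (f - R) ^ 5 := mul_nonneg (mul_nonneg (hts) (hR)) (pow_nonneg hRf 5)
  have g25 : (0 : ℝ) ≤ (1 / 2 - f) * R ^ 2 := mul_nonneg (hts) (pow_nonneg hR 2)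
  have g26 : (0 : ℝ) ≤ (1 / 2 - f) * R ^ 2 * (f - R) ^ 4 := mul_nonneg (mul_nonneg (hts) (pow_nonneg hR 2)) (pow_nonneg hRf 4)
  have g27 : (0 : ℝ) ≤ (1 / 2 - f) * R ^ 3 * (f - R) := mul_nonneg (mul_nonneg (hts) (pow_nonneg hR 3)) (hRf)
  have g28 : (0 : ℝ) ≤ (1 / 2 - f) * R ^ 3 * (f - R) ^ 2 := mul_nonneg (mul_nonneg (hts) (pow_nonneg hR 3)) (pow_nonneg hRf 2)
  have g29 : (0 : ℝ) ≤ (1 / 2 - f) * R ^ 4 := mul_nonneg (hts) (pow_nonneg hR 4)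
  have g30 : (0 : ℝ) ≤ (1 / 2 - f) * R ^ 4 * (f - R) := mul_nonneg (mul_nonneg (hts) (pow_nonneg hR 4)) (hRf)
  have g31 : (0 : ℝ) ≤ (1 / 2 - f) ^ 2 := pow_nonneg hts 2
  have g32 : (0 : ℝ) ≤ (1 / 2 - f) ^ 2 * R ^ 2 := mul_nonneg (pow_nonneg hts 2) (pow_nonneg hR 2)
  have g33 : (0 : ℝ) ≤ (1 / 2 - f) ^ 2 * R ^ 4 := mul_nonneg (pow_nonneg hts 2) (pow_nonneg hR 4)
  have g34 : (0 : ℝ) ≤ (1 / 2 - f) ^ 2 * R ^ 5 := mul_nonneg (pow_nonneg hts 2) (pow_nonneg hR 5)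
  linarith [g0, g1, g2, g3, g4, g5, g6, g7, g8, g9, g10, g11, g12, g13, g14, g15, g16, g17, g18, g19, g20, g21, g22, g23, g24, g25, g26, g27, g28, g29, g30, g31, g32, g33, g34]

/-- **Helper `helper_levelSetCert_chunk0` (registered)**: the level-set certificate inequality of STUB 19 on the chunk `0 ≤ f ≤ 1 / 2` (`0 ≤ R ≤ f`): `Q = P₀ + e^{-f}P_e + e^{7/2−f}P_E`, each exponential is sandwiched between rational multiples of the Taylor envelopes at `s = f − 0`, and on each `R`-sub-range the sign of `P_E = ½R(2−R)` and a case split on the sign of `P_e` reduce the claim to the polynomial certificates above. [folklore] -/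
theorem helper_levelSetCert_chunk0 :
    ∀ f R : ℝ, 0 ≤ f → f ≤ 1 / 2 → 0 ≤ R → R ≤ f →
      38 / 5 * Real.exp (-f) - 2 + 11 / 10 * (R - 2) + 177 / 10 * (f - 2) * Real.exp (-f)
          - 18 / 5 * ((f - R) - (f - 2) ^ 2) * Real.exp (-f)
          + 12 / 25 * ((f - R) * (3 - R) - (R - 2) ^ 2)
          + 1 / 2 * R * (2 - R) * (Real.exp (7 / 2 - f) - 1) ≤ 0 := by
  intro f R hf0 hf1 hR hRf'
  have hs : 0 ≤ f := by linarith
  have hts : 0 ≤ 1 / 2 - f := by linarith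
  have hRf : 0 ≤ f - R := by linarith
  obtain ⟨he1, he2⟩ := exp_neg_bounds_0 f hf0 hf1
  obtain ⟨hE1, hE2⟩ := exp_sub_bounds_0 f hf0 hf1
  have key : 38 / 5 * Real.exp (-f) - 2 + 11 / 10 * (R - 2) + 177 / 10 * (f - 2) * Real.exp (-f)
          - 18 / 5 * ((f - R) - (f - 2) ^ 2) * Real.exp (-f)
          + 12 / 25 * ((f - R) * (3 - R) - (R - 2) ^ 2)
          + 1 / 2 * R * (2 - R) * (Real.exp (7 / 2 - f) - 1)
        = (-2 + 11 / 10 * (R - 2) + 12 / 25 * ((f - R) * (3 - R) - (R - 2) ^ 2) - 1 / 2 * R * (2 - R)) + Real.exp (-f) * (38 / 5 + 177 / 10 * (f - 2) - 18 / 5 * ((f - R) - (f - 2) ^ 2))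
          + Real.exp (7 / 2 - f) * (1 / 2 * R * (2 - R)) := by ring
  rw [key]
  have hPE : 0 ≤ (1 / 2 * R * (2 - R)) := by nlinarith
  have hE : Real.exp (7 / 2 - f) * (1 / 2 * R * (2 - R)) ≤ (1655773 / 50000 * ((1 - f + f ^ 2 / 2 - f ^ 3 / 6 + f ^ 4 / 24) + f ^ 5 / 100)) * (1 / 2 * R * (2 - R)) :=
    mul_le_mul_of_nonneg_right hE2 hPE
  rcases le_total 0 (38 / 5 + 177 / 10 * (f - 2) - 18 / 5 * ((f - R) - (f - 2) ^ 2)) with hp | hp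
  · have he : Real.exp (-f) * (38 / 5 + 177 / 10 * (f - 2) - 18 / 5 * ((f - R) - (f - 2) ^ 2)) ≤ (1 * ((1 - f + f ^ 2 / 2 - f ^ 3 / 6 + f ^ 4 / 24) + f ^ 5 / 100)) * (38 / 5 + 177 / 10 * (f - 2) - 18 / 5 * ((f - R) - (f - 2) ^ 2)) :=
      mul_le_mul_of_nonneg_right he2 hp
    have hc := cert_0_0_hi f R hs hts hR hRf
    linarith [he, hE, hc]
  · have he : Real.exp (-f) * (38 / 5 + 177 / 10 * (f - 2) - 18 / 5 * ((f - R) - (f - 2) ^ 2)) ≤ (1 * ((1 - f + f ^ 2 / 2 - f ^ 3 / 6 + f ^ 4 / 24) - f ^ 5 / 100)) * (38 / 5 + 177 / 10 * (f - 2) - 18 / 5 * ((f - R) - (f - 2) ^ 2)) :=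
      mul_le_mul_of_nonpos_right he1 hp
    have hc := cert_0_0_lo f R hs hts hR hRf
    linarith [he, hE, hc]

end Summit.SmoothPoincare4.SmoothPoincare4.Theorems

end
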